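import Mathlib.GroupTheory.SpecificGroups.Dihedral
import Mathlib.Data.ZMod.Basic
import Mathlib.Tactic
import Literature.Combinatorics.Additive.TripleProductProperty
import Literature.Computability.AlgebraicComplexity.CohnUmansTPP
import HarnessLib
import Summits.MatrixMultiplication.OmegaCensus.CyclicDihedralIndexTwoFamily

/-!
# Cyclic × dihedral index-2 families, part 3: the diagonal families for `K = 2M` and for general `K` with `M ∣ K`

Continuation of `CyclicDihedralIndexTwoFamily.lean` (source: speedrun lane `tpp`, seat `sr-tpp-search-g10`, tree-ready file v4
sha256 `6da5cbb8bc90032184cc9ca72310b88096c9c8c6bbd0a339081b60eedce46753`; split at section boundaries by the cell `pub-omega`, seat pub-omega-group-g3, ruling L5-9 (2), for the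
400-line rule; a docstring added to every declaration; statements and proofs verbatim).  Contents: section `diag2` — `(4m+2, 4m, 2)` in `C_{4m+2} × D_{2(2m+1)}`; section `diagK` — for every odd `M = 2m+1` and `K ≥ M` with `M ∣ K`, `C_K × D_{2M}` realizes `⟨K, 2M−2, 2⟩` (volume `4K(M−1) = 2|G|(1 − 1/M)`).
HONEST FRAMING: explicit TPP families (census lower bounds); nothing on `ω`.
Framing: lottery ticket; floor = certified bounds/negative ranges.
-/

namespace Summit.MatrixMultiplication.OmegaCensus.CyclicDihedralIndexTwoFamily

open Literature.Computability.AlgebraicComplexity Literature.Combinatorics.Additive DihedralGroup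

variable {K M : ℕ}
section diag2
variable (m : ℕ)

/-! ### The diagonal family with `K = 2M`: `C_{2M} × D_{2M}` realizes `⟨2M, 2M−2, 2⟩` (volume `8M(M−1) = 2|G| − 8M`)
(hand proof for all odd `M ∣ K`: `C_K × D_{2M}` realizes `⟨K, 2M−2, 2⟩`; exact census: `β(C_6 × D_6) = 48`, `β(C_{10} × D_{10}) = 160`.) -/

/-- First set of the second diagonal family in `C_{4m+2} × D_{2(2m+1)}`. [folklore] -/
def Sd2 : Finset (Grp (4 * m + 2) (2 * m + 1)) :=
  (Finset.range (4 * m + 2)).image fun i : ℕ => rot (4 * m + 2) (2 * m + 1) (i : ℤ) (-(i : ℤ))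
/-- Second set of the second diagonal family. [folklore] -/
def Td2 : Finset (Grp (4 * m + 2) (2 * m + 1)) :=
  ((Finset.range (2 * m)).image fun x : ℕ => rot (4 * m + 2) (2 * m + 1) ((x : ℤ) + 1) ((x : ℤ) + 1)) ∪
  ((Finset.range (2 * m)).image fun x : ℕ => ref (4 * m + 2) (2 * m + 1) ((x : ℤ) + 1) (-((x : ℤ) + 1)))
/-- Third set of the second diagonal family. [folklore] -/
def Ud2 : Finset (Grp (4 * m + 2) (2 * m + 1)) :=
  {rot (4 * m + 2) (2 * m + 1) 0 0, ref (4 * m + 2) (2 * m + 1) 0 0}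

/-- `|Sd2 m| = 4m + 2`. [folklore] -/
theorem card_Sd2 : (Sd2 m).card = 4 * m + 2 := by
  rw [Sd2, Finset.card_image_of_injOn, Finset.card_range]
  intro i hi i' hi' he
  simp only [Finset.coe_range, Set.mem_Iio] at hi hi'
  obtain ⟨hA, -⟩ := (rot_eq_rot_iff _ _ _ _).mp he
  have hK : (0 : ℤ) < ((4 * m + 2 : ℕ) : ℤ) := by positivity
  rcases dvd_window2 hK hA (by push_cast; omega) (by push_cast; omega) with hA | hA | hA <;>
    (push_cast at hA; omega)

/-- `|Td2 m| = 4m`. [folklore] -/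
theorem card_Td2 : (Td2 m).card = 4 * m := by
  have hK : (0 : ℤ) < ((4 * m + 2 : ℕ) : ℤ) := by positivity
  rw [Td2, Finset.card_union_of_disjoint, Finset.card_image_of_injOn, Finset.card_image_of_injOn, Finset.card_range]
  · omega
  · intro i hi i' hi' he
    simp only [Finset.coe_range, Set.mem_Iio] at hi hi'
    obtain ⟨hA, -⟩ := (ref_eq_ref_iff _ _ _ _).mp he
    rcases dvd_window2 hK hA (by push_cast; omega) (by push_cast; omega) with hA | hA | hA <;>
      (push_cast at hA; omega)
  · intro i hi i' hi' he
    simp only [Finset.coe_range, Set.mem_Iio] at hi hi'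
    obtain ⟨hA, -⟩ := (rot_eq_rot_iff _ _ _ _).mp he
    rcases dvd_window2 hK hA (by push_cast; omega) (by push_cast; omega) with hA | hA | hA <;>
      (push_cast at hA; omega)
  · rw [Finset.disjoint_left]
    intro x hx hx'
    simp only [Finset.mem_image, Finset.mem_range] at hx hx'
    obtain ⟨j, -, rfl⟩ := hx
    obtain ⟨i, -, hc⟩ := hx'
    simp at hc

/-- `|Ud2 m| = 2`. [folklore] -/
theorem card_Ud2 : (Ud2 m).card = 2 := by
  rw [Ud2, Finset.card_pair]
  simp

set_option maxHeartbeats 0 in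
/-- **The triple `(Sd2 m, Td2 m, Ud2 m)` has the triple product property** in `C_{4m+2} × D_{2(2m+1)}`. [folklore] -/
theorem tpp_diag2 :
    ∀ s ∈ Sd2 m, ∀ s' ∈ Sd2 m, ∀ t ∈ Td2 m, ∀ t' ∈ Td2 m, ∀ u ∈ Ud2 m, ∀ u' ∈ Ud2 m,
      s * s'⁻¹ * (t * t'⁻¹) * (u * u'⁻¹) = 1 → s = s' ∧ t = t' ∧ u = u' := by
  have hK : (0 : ℤ) < ((4 * m + 2 : ℕ) : ℤ) := by positivity
  have hM : (0 : ℤ) < ((2 * m + 1 : ℕ) : ℤ) := by positivity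
  intro s hs s' hs' t ht t' ht' u hu u' hu' he
  simp only [Sd2, Td2, Ud2, Finset.mem_image, Finset.mem_range, Finset.mem_union, Finset.mem_insert,
    Finset.mem_singleton] at hs hs' ht ht' hu hu'
  obtain ⟨i, hi, rfl⟩ := hs
  obtain ⟨i', hi', rfl⟩ := hs'
  rcases ht with ⟨x, hx, rfl⟩ | ⟨x, hx, rfl⟩ <;> rcases ht' with ⟨x', hx', rfl⟩ | ⟨x', hx', rfl⟩ <;>
  rcases hu with rfl | rfl <;> rcases hu' with rfl | rfl <;>
  simp only [rot_mul_rot, rot_mul_ref, ref_mul_rot, ref_mul_ref, rot_inv, ref_inv, rot_eq_one_iff,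
    ref_ne_one] at he
  all_goals (
    obtain ⟨hA, hB⟩ := he
    rcases dvd_window2 hK hA (by omega) (by omega) with hA | hA | hA <;>
    rcases dvd_window6 hM hB (by omega) (by omega) with hB | hB | hB | hB | hB | hB | hB | hB | hB | hB | hB <;>
    first
      | (exfalso; omega)
      | (obtain rfl : i = i' := by omega
         obtain rfl : x = x' := by omega
         exact ⟨rfl, rfl, rfl⟩))

/-- `C_{2M} × D_{2M}` realizes `⟨2M, 2M−2, 2⟩` for every odd `M = 2m+1`. -/
theorem realizesTPP_diag2 :
    RealizesTPP (Grp (4 * m + 2) (2 * m + 1)) (4 * m + 2) (4 * m) 2 :=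
  ⟨Sd2 m, Td2 m, Ud2 m, card_Sd2 m, card_Td2 m, card_Ud2 m, tpp_diag2 m⟩

/-- `TripleProductProperty` form of `tpp_diag2`. [folklore] -/
theorem tripleProductProperty_diag2 : TripleProductProperty (Sd2 m) (Td2 m) (Ud2 m) := tpp_diag2 m

/-- Existence form: a TPP triple of sizes `(4m+2, 4m, 2)` in `C_{4m+2} × D_{2(2m+1)}`. [folklore] -/
theorem exists_tpp_diag2 : ∃ A B C : Finset (Grp (4 * m + 2) (2 * m + 1)),
    TripleProductProperty A B C ∧ A.card = 4 * m + 2 ∧ B.card = 4 * m ∧ C.card = 2 :=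
  ⟨Sd2 m, Td2 m, Ud2 m, tpp_diag2 m, card_Sd2 m, card_Td2 m, card_Ud2 m⟩

/-- `|C_{4m+2} × D_{2(2m+1)}| = 4(2m+1)²`. [folklore] -/
theorem card_Grp2 : Fintype.card (Grp (4 * m + 2) (2 * m + 1)) = 4 * (2 * m + 1) ^ 2 := by
  simp [Fintype.card_prod, ZMod.card, DihedralGroup.card]; ring

/-- volume `(4m+2)(4m)2 = 2|G| − 8M`. -/
theorem diag2_summary :
    RealizesTPP (Grp (4 * m + 2) (2 * m + 1)) (4 * m + 2) (4 * m) 2 ∧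
    (4 * m + 2) * (4 * m) * 2 + 8 * (2 * m + 1) = 2 * Fintype.card (Grp (4 * m + 2) (2 * m + 1)) :=
  ⟨realizesTPP_diag2 m, by rw [card_Grp2]; ring⟩

end diag2

section diagK
variable (K m : ℕ)

/-! ### The diagonal family for general `K` with `M ∣ K` (`M = 2m+1` odd): `C_K × D_{2M}` realizes `⟨K, 2M−2, 2⟩`,
volume `4K(M−1) = 2|G|(1 − 1/M)`.  `SdK = {(i, r(−i)) : i < K}` is the graph subgroup of the reduction `ZMod K → ZMod M`;
`TdK`, `UdK` as in section `diag`.  The proof uses only `M ∣ K` (transitivity of `∣`) and that `M` is odd.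
Exact census (lane tpp): `β(C_K × D_{2M}) = 4K(M−1)` for all ten such groups of order `≤ 127`. -/

/-- First set of the general diagonal family: the graph `{(i, r(−i))}` of the reduction `ZMod K → ZMod M`. [folklore] -/
def SdK : Finset (Grp K (2 * m + 1)) :=
  (Finset.range K).image fun i : ℕ => rot K (2 * m + 1) (i : ℤ) (-(i : ℤ))
/-- Second set of the general diagonal family (`4m` elements, as in section `diag`). [folklore] -/
def TdK : Finset (Grp K (2 * m + 1)) :=
  ((Finset.range (2 * m)).image fun x : ℕ => rot K (2 * m + 1) ((x : ℤ) + 1) ((x : ℤ) + 1)) ∪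
  ((Finset.range (2 * m)).image fun x : ℕ => ref K (2 * m + 1) ((x : ℤ) + 1) (-((x : ℤ) + 1)))
/-- Third set of the general diagonal family: `{1, (0, sr 0)}`. [folklore] -/
def UdK : Finset (Grp K (2 * m + 1)) := {rot K (2 * m + 1) 0 0, ref K (2 * m + 1) 0 0}

/-- `|SdK K m| = K`. [folklore] -/
theorem card_SdK : (SdK K m).card = K := by
  rw [SdK, Finset.card_image_of_injOn, Finset.card_range]
  intro i hi i' hi' he
  simp only [Finset.coe_range, Set.mem_Iio] at hi hi'
  obtain ⟨hA, -⟩ := (rot_eq_rot_iff _ _ _ _).mp he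
  have hKpos : (0 : ℤ) < (K : ℤ) := by omega
  rcases dvd_window2 hKpos hA (by omega) (by omega) with hA | hA | hA <;> omega

/-- `|TdK K m| = 4m` (for `2m+1 ≤ K`). [folklore] -/
theorem card_TdK (hK : 2 * m + 1 ≤ K) : (TdK K m).card = 4 * m := by
  have hKpos : (0 : ℤ) < (K : ℤ) := by omega
  rw [TdK, Finset.card_union_of_disjoint, Finset.card_image_of_injOn, Finset.card_image_of_injOn, Finset.card_range]
  · omega
  · intro i hi i' hi' he
    simp only [Finset.coe_range, Set.mem_Iio] at hi hi'
    obtain ⟨hA, -⟩ := (ref_eq_ref_iff _ _ _ _).mp he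
    rcases dvd_window2 hKpos hA (by omega) (by omega) with hA | hA | hA <;> omega
  · intro i hi i' hi' he
    simp only [Finset.coe_range, Set.mem_Iio] at hi hi'
    obtain ⟨hA, -⟩ := (rot_eq_rot_iff _ _ _ _).mp he
    rcases dvd_window2 hKpos hA (by omega) (by omega) with hA | hA | hA <;> omega
  · rw [Finset.disjoint_left]
    intro x hx hx'
    simp only [Finset.mem_image, Finset.mem_range] at hx hx'
    obtain ⟨j, -, rfl⟩ := hx
    obtain ⟨i, -, hc⟩ := hx'
    simp at hc

/-- `|UdK K m| = 2`. [folklore] -/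
theorem card_UdK : (UdK K m).card = 2 := by
  rw [UdK, Finset.card_pair]
  simp

set_option maxHeartbeats 0 in
/-- **The general diagonal triple has the triple product property** in `C_K × D_{2(2m+1)}` whenever `2m+1 ∣ K`. [folklore] -/
theorem tpp_diagK (hK : 2 * m + 1 ≤ K) (hMK : ((2 * m + 1 : ℕ) : ℤ) ∣ (K : ℤ)) :
    ∀ s ∈ SdK K m, ∀ s' ∈ SdK K m, ∀ t ∈ TdK K m, ∀ t' ∈ TdK K m, ∀ u ∈ UdK K m, ∀ u' ∈ UdK K m,
      s * s'⁻¹ * (t * t'⁻¹) * (u * u'⁻¹) = 1 → s = s' ∧ t = t' ∧ u = u' := by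
  have hKpos : (0 : ℤ) < (K : ℤ) := by omega
  have hM : (0 : ℤ) < ((2 * m + 1 : ℕ) : ℤ) := by positivity
  intro s hs s' hs' t ht t' ht' u hu u' hu' he
  simp only [SdK, TdK, UdK, Finset.mem_image, Finset.mem_range, Finset.mem_union, Finset.mem_insert,
    Finset.mem_singleton] at hs hs' ht ht' hu hu'
  obtain ⟨i, hi, rfl⟩ := hs
  obtain ⟨i', hi', rfl⟩ := hs'
  rcases ht with ⟨x, hx, rfl⟩ | ⟨x, hx, rfl⟩ <;> rcases ht' with ⟨x', hx', rfl⟩ | ⟨x', hx', rfl⟩ <;>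
  rcases hu with rfl | rfl <;> rcases hu' with rfl | rfl <;>
  simp only [rot_mul_rot, rot_mul_ref, ref_mul_rot, ref_mul_ref, rot_inv, ref_inv, rot_eq_one_iff,
    ref_ne_one] at he
  all_goals (
    obtain ⟨hA, hB⟩ := he
    have hS := dvd_add (dvd_trans hMK hA) hB
    rcases dvd_window2 hM hS (by omega) (by omega) with hS | hS | hS <;>
    rcases dvd_window2 hKpos hA (by omega) (by omega) with hA | hA | hA <;>
    first
      | (exfalso; omega)
      | (obtain rfl : i = i' := by omega
         obtain rfl : x = x' := by omega
         exact ⟨rfl, rfl, rfl⟩))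

/-- **The diagonal family, general form**: for every odd `M = 2m+1` and every `K ≥ M` with `M ∣ K`,
`C_K × D_{2M}` realizes `⟨K, 2M−2, 2⟩` (volume `4K(M−1) = 2|G|(1 − 1/M)`). -/
theorem realizesTPP_diagK (hK : 2 * m + 1 ≤ K) (hMK : (2 * m + 1) ∣ K) :
    RealizesTPP (Grp K (2 * m + 1)) K (4 * m) 2 :=
  ⟨SdK K m, TdK K m, UdK K m, card_SdK K m, card_TdK K m hK, card_UdK K m,
    tpp_diagK K m hK (by exact_mod_cast hMK)⟩

/-- `TripleProductProperty` form of `tpp_diagK`. [folklore] -/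
theorem tripleProductProperty_diagK (hK : 2 * m + 1 ≤ K) (hMK : (2 * m + 1) ∣ K) :
    TripleProductProperty (SdK K m) (TdK K m) (UdK K m) := tpp_diagK K m hK (by exact_mod_cast hMK)

/-- Existence form: a TPP triple of sizes `(K, 4m, 2)` in `C_K × D_{2(2m+1)}` (`2m+1 ∣ K`). [folklore] -/
theorem exists_tpp_diagK (hK : 2 * m + 1 ≤ K) (hMK : (2 * m + 1) ∣ K) : ∃ A B C : Finset (Grp K (2 * m + 1)),
    TripleProductProperty A B C ∧ A.card = K ∧ B.card = 4 * m ∧ C.card = 2 :=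
  ⟨SdK K m, TdK K m, UdK K m, tpp_diagK K m hK (by exact_mod_cast hMK), card_SdK K m, card_TdK K m hK, card_UdK K m⟩

/-- `|C_K × D_{2(2m+1)}| = 2K(2m+1)`. [folklore] -/
theorem card_GrpK [NeZero K] : Fintype.card (Grp K (2 * m + 1)) = K * (2 * (2 * m + 1)) := by
  simp [Fintype.card_prod, ZMod.card, DihedralGroup.card]

/-- Summary for `M ∣ K`: `|G| = 2KM` and the volume satisfies `K(2M−2)2 + 4K = 2|G|`, i.e. `β/|G| ≥ 2 − 2/M`. -/
theorem diagK_summary [NeZero K] (hK : 2 * m + 1 ≤ K) (hMK : (2 * m + 1) ∣ K) :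
    RealizesTPP (Grp K (2 * m + 1)) K (4 * m) 2 ∧
    K * (4 * m) * 2 + 4 * K = 2 * Fintype.card (Grp K (2 * m + 1)) :=
  ⟨realizesTPP_diagK K m hK hMK, by rw [card_GrpK]; ring⟩

/-- instance check: `C_{15} × D_{10}` (order 150, lane id AG-150-7) realizes `⟨15, 8, 2⟩` = 240 (the census's best lower bound). -/
example : RealizesTPP (Grp 15 5) 15 8 2 := realizesTPP_diagK 15 2 (by norm_num) (by norm_num)

end diagK


end Summit.MatrixMultiplication.OmegaCensus.CyclicDihedralIndexTwoFamily
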